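import Literature.NumberTheory.LFunctions.WeilFinitePrimeQuadraticChar
import Summits.Ventures.WeilGRH.RungLogBounds
import HarnessLib

/-!
# The twisted prime ripple: one prime power at a time, and the trivial bound with the coprimality pattern

Cell `rh-explicit`, WEIL TRACK — GRH ARM, route B (weil-grh-3).  The twisted finite-prime Weil weight
`M_{χ,N}(τ) = Re ψ(1/4 + a_χ/2 + iτ/2) + log q − log π − ρ_{χ,N}(τ)` (`weilFinitePrimeWeightChar`) sees the
character only through the ripple

  `ρ_{χ,N}(τ) = Σ_{n ≤ N} (Λ(n)/√n) · 2 (Re χ(n) cos(τ log n) + Im χ(n) sin(τ log n))`  (`weilPrimeRippleChar`).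

This file records the elementary bookkeeping used by the PARTIAL-KEY and UNIVERSAL (archimedean-only)
certificates of the arm (`DualTrigKernelPartial.lean`): the one-step recursion `ρ_{χ,N+1} = ρ_{χ,N} + (term)`,
the trivial bound `|term_n| ≤ 2Λ(n)/√n` (`‖χ(n)‖ ≤ 1`, Cauchy–Schwarz), the vanishing of the term when
`(n, q) > 1` (`χ(n) = 0`) or `n` is not a prime power (`Λ(n) = 0`), the resulting bound with the
coprimality pattern of the modulus

  `|ρ_{χ,N}(τ)| ≤ B_N(q) := Σ_{n ≤ N, (n, q) = 1} 2Λ(n)/√n`   (`abs_weilPrimeRippleChar_le_sum`),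

and decimal values of the coefficients `2Λ(n)/√n`, `2 ≤ n ≤ 9` (`log 2, 3, 5` to nine places from Mathlib,
`log 7` from `RungLogBounds`, square roots by squaring).  Everything here is PROVED; no named facts.

## References

* A. Weil, *Sur les "formules explicites" de la théorie des nombres premiers*, Comm. Sém. Math. Univ.
  Lund, tome suppl. (1952), (11) pp. 261–262 (the prime-power terms carry `χ(𝔭)ⁿ` with `|χ| ≤ 1`).
  [folklore consequences]
-/

noncomputable section

open Finset Real Complex

namespace Summit.Ventures.WeilGRH

open Literature.NumberTheory.LFunctions
open scoped ArithmeticFunction.vonMangoldt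

/-! ### The twisted prime ripple one prime power at a time -/

section ripple

variable {q : ℕ}

/-- `ρ_{χ,N+1} = ρ_{χ,N} + (Λ(N+1)/√(N+1)) · 2 Re(χ(N+1) e^{−iτ log(N+1)})`. [folklore] -/
theorem weilPrimeRippleChar_succ (χ : DirichletCharacter ℂ q) (N : ℕ) (τ : ℝ) :
    weilPrimeRippleChar χ (N + 1) τ = weilPrimeRippleChar χ N τ +
      (Λ (N + 1) : ℝ) / Real.sqrt ((N + 1 : ℕ) : ℝ) *
        (2 * ((χ ((N + 1 : ℕ) : ZMod q)).re * Real.cos (τ * Real.log ((N + 1 : ℕ) : ℝ)) +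
          (χ ((N + 1 : ℕ) : ZMod q)).im * Real.sin (τ * Real.log ((N + 1 : ℕ) : ℝ)))) := by
  unfold weilPrimeRippleChar
  rw [Finset.sum_range_succ]

/-- `ρ_{χ,0} = 0`. [folklore] -/
theorem weilPrimeRippleChar_zero (χ : DirichletCharacter ℂ q) (τ : ℝ) : weilPrimeRippleChar χ 0 τ = 0 := by
  unfold weilPrimeRippleChar
  simp

/-- `ρ_{χ,1} = 0` (no prime power `≤ 1`). [folklore] -/
theorem weilPrimeRippleChar_one (χ : DirichletCharacter ℂ q) (τ : ℝ) : weilPrimeRippleChar χ 1 τ = 0 := by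
  rw [show (1 : ℕ) = 0 + 1 from rfl, weilPrimeRippleChar_succ, weilPrimeRippleChar_zero]
  simp

/-- `|Re z cos θ + Im z sin θ| ≤ ‖z‖` (Cauchy–Schwarz in `ℝ²`). [folklore] -/
theorem abs_re_mul_cos_add_im_mul_sin_le (z : ℂ) (θ : ℝ) :
    |z.re * Real.cos θ + z.im * Real.sin θ| ≤ ‖z‖ := by
  have hcs : Real.cos θ ^ 2 + Real.sin θ ^ 2 = 1 := Real.cos_sq_add_sin_sq θ
  have hz : ‖z‖ ^ 2 = z.re ^ 2 + z.im ^ 2 := by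
    rw [Complex.sq_norm, Complex.normSq_apply]; ring
  have hid : (z.re * Real.cos θ + z.im * Real.sin θ) ^ 2 + (z.re * Real.sin θ - z.im * Real.cos θ) ^ 2 =
      (z.re ^ 2 + z.im ^ 2) * (Real.cos θ ^ 2 + Real.sin θ ^ 2) := by ring
  have hsq : (z.re * Real.cos θ + z.im * Real.sin θ) ^ 2 ≤ ‖z‖ ^ 2 := by
    rw [hz]; nlinarith [sq_nonneg (z.re * Real.sin θ - z.im * Real.cos θ)]
  exact abs_le.2 (abs_le_of_sq_le_sq' hsq (norm_nonneg z))

/-- The trivial bound on one summand of the ripple: `|Λ(n)/√n · 2 Re(χ(n) e^{−iτ log n})| ≤ 2Λ(n)/√n`.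
[folklore] -/
theorem abs_ripple_summand_le (χ : DirichletCharacter ℂ q) (n : ℕ) (τ : ℝ) :
    |(Λ n : ℝ) / Real.sqrt (n : ℝ) * (2 * ((χ (n : ZMod q)).re * Real.cos (τ * Real.log (n : ℝ)) +
      (χ (n : ZMod q)).im * Real.sin (τ * Real.log (n : ℝ))))| ≤ 2 * (Λ n : ℝ) / Real.sqrt (n : ℝ) := by
  have hΛ : 0 ≤ (Λ n : ℝ) := ArithmeticFunction.vonMangoldt_nonneg
  have hc : 0 ≤ (Λ n : ℝ) / Real.sqrt (n : ℝ) := div_nonneg hΛ (Real.sqrt_nonneg _)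
  have h1 := abs_re_mul_cos_add_im_mul_sin_le (χ (n : ZMod q)) (τ * Real.log (n : ℝ))
  have h2 : ‖χ (n : ZMod q)‖ ≤ 1 := DirichletCharacter.norm_le_one χ _
  rw [abs_mul, abs_of_nonneg hc, abs_mul, abs_of_pos (by norm_num : (0 : ℝ) < 2)]
  calc (Λ n : ℝ) / Real.sqrt (n : ℝ) * (2 * |(χ (n : ZMod q)).re * Real.cos (τ * Real.log (n : ℝ)) +
        (χ (n : ZMod q)).im * Real.sin (τ * Real.log (n : ℝ))|)
      ≤ (Λ n : ℝ) / Real.sqrt (n : ℝ) * (2 * 1) := by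
        exact mul_le_mul_of_nonneg_left (by linarith) hc
    _ = 2 * (Λ n : ℝ) / Real.sqrt (n : ℝ) := by ring

/-- A summand of the ripple vanishes when `n` is not coprime to the modulus (`χ(n) = 0`). [folklore] -/
theorem ripple_summand_eq_zero_of_not_coprime (χ : DirichletCharacter ℂ q) {n : ℕ} (h : ¬ Nat.Coprime n q)
    (τ : ℝ) :
    (Λ n : ℝ) / Real.sqrt (n : ℝ) * (2 * ((χ (n : ZMod q)).re * Real.cos (τ * Real.log (n : ℝ)) +
      (χ (n : ZMod q)).im * Real.sin (τ * Real.log (n : ℝ)))) = 0 := by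
  have hz : χ (n : ZMod q) = 0 := χ.map_nonunit (fun hu ↦ h ((ZMod.isUnit_iff_coprime n q).1 hu))
  simp [hz]

/-- A summand of the ripple vanishes when `n` is not a prime power (`Λ(n) = 0`). [folklore] -/
theorem ripple_summand_eq_zero_of_not_isPrimePow (χ : DirichletCharacter ℂ q) {n : ℕ} (h : ¬ IsPrimePow n)
    (τ : ℝ) :
    (Λ n : ℝ) / Real.sqrt (n : ℝ) * (2 * ((χ (n : ZMod q)).re * Real.cos (τ * Real.log (n : ℝ)) +
      (χ (n : ZMod q)).im * Real.sin (τ * Real.log (n : ℝ)))) = 0 := by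
  rw [ArithmeticFunction.vonMangoldt_eq_zero_iff.2 h]; simp

/-- **One step of the trivial bound**: `|ρ_{χ,M}(τ) − ρ_{χ,N}(τ)| ≤ 2Λ(M)/√M` for `M = N + 1` (stated with
a separate numeral `M` so that instances are syntactically uniform). [folklore] -/
theorem abs_weilPrimeRippleChar_succ_sub_le (χ : DirichletCharacter ℂ q) {N M : ℕ} (hM : M = N + 1) (τ : ℝ) :
    |weilPrimeRippleChar χ M τ - weilPrimeRippleChar χ N τ| ≤ 2 * (Λ M : ℝ) / Real.sqrt (M : ℝ) := by
  subst hM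
  rw [weilPrimeRippleChar_succ, add_sub_cancel_left]
  exact abs_ripple_summand_le χ (N + 1) τ

/-- The step is `0` when `M = N+1` is not coprime to the modulus. [folklore] -/
theorem weilPrimeRippleChar_succ_of_not_coprime (χ : DirichletCharacter ℂ q) {N M : ℕ} (hM : M = N + 1)
    (h : ¬ Nat.Coprime M q) (τ : ℝ) :
    weilPrimeRippleChar χ M τ = weilPrimeRippleChar χ N τ := by
  subst hM
  rw [weilPrimeRippleChar_succ, ripple_summand_eq_zero_of_not_coprime χ h, add_zero]

/-- The step is `0` when `M = N+1` is not a prime power. [folklore] -/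
theorem weilPrimeRippleChar_succ_of_not_isPrimePow (χ : DirichletCharacter ℂ q) {N M : ℕ} (hM : M = N + 1)
    (h : ¬ IsPrimePow M) (τ : ℝ) :
    weilPrimeRippleChar χ M τ = weilPrimeRippleChar χ N τ := by
  subst hM
  rw [weilPrimeRippleChar_succ, ripple_summand_eq_zero_of_not_isPrimePow χ h, add_zero]

/-- **The trivial bound with the coprimality pattern of the modulus**:
`|ρ_{χ,N}(τ)| ≤ B_N(q) := Σ_{n ≤ N, (n, q) = 1} 2Λ(n)/√n` (only prime powers contribute: `Λ(n) = 0` otherwise).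
This is the `B` of the universal rungs: a key-free multiplier certificate of parity `a` with constant
`log c.q` proves the rung for every character of parity `a` and conductor `log q ≥ log c.q + B_N(q)`.
[folklore] -/
theorem abs_weilPrimeRippleChar_le_sum (χ : DirichletCharacter ℂ q) (N : ℕ) (τ : ℝ) :
    |weilPrimeRippleChar χ N τ| ≤
      ∑ n ∈ Finset.range (N + 1), if Nat.Coprime n q then 2 * (Λ n : ℝ) / Real.sqrt (n : ℝ) else 0 := by
  induction N with
  | zero =>
      rw [weilPrimeRippleChar_zero, abs_zero, Finset.sum_range_one]
      split_ifs <;> simp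
  | succ N ih =>
      rw [Finset.sum_range_succ]
      by_cases hco : Nat.Coprime (N + 1) q
      · rw [if_pos hco]
        have h := abs_weilPrimeRippleChar_succ_sub_le χ (N := N) (M := N + 1) rfl τ
        calc |weilPrimeRippleChar χ (N + 1) τ|
            = |weilPrimeRippleChar χ N τ + (weilPrimeRippleChar χ (N + 1) τ - weilPrimeRippleChar χ N τ)| := by
              ring_nf
          _ ≤ |weilPrimeRippleChar χ N τ| + |weilPrimeRippleChar χ (N + 1) τ - weilPrimeRippleChar χ N τ| :=
              abs_add_le _ _
          _ ≤ _ := add_le_add ih h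
      · rw [if_neg hco, add_zero, weilPrimeRippleChar_succ_of_not_coprime χ rfl hco]
        exact ih

/-- `6` is not a prime power. [folklore] -/
theorem not_isPrimePow_six : ¬ IsPrimePow 6 := by
  intro h
  rw [isPrimePow_nat_iff] at h
  obtain ⟨p, k, hp, hk, hpk⟩ := h
  have h2 : 2 ∣ p ^ k := by rw [hpk]; norm_num
  have h3 : 3 ∣ p ^ k := by rw [hpk]; norm_num
  have h2' := (Nat.prime_dvd_prime_iff_eq Nat.prime_two hp).1 (Nat.prime_two.dvd_of_dvd_pow h2)
  have h3' := (Nat.prime_dvd_prime_iff_eq Nat.prime_three hp).1 (Nat.prime_three.dvd_of_dvd_pow h3)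
  omega

/-! ### Numeric values of the coefficients `2Λ(n)/√n`, `2 ≤ n ≤ 9` -/

/-- `2Λ(2)/√2 = √2 log 2 ≤ 0.9803`. [folklore] -/
theorem two_vonMangoldt_div_sqrt_two_le : 2 * (Λ 2 : ℝ) / Real.sqrt ((2 : ℕ) : ℝ) ≤ 9803 / 10000 := by
  rw [ArithmeticFunction.vonMangoldt_apply_prime Nat.prime_two]
  push_cast
  have hs : (14142135 : ℝ) / 10000000 ≤ Real.sqrt 2 := (Real.le_sqrt (by norm_num) (by norm_num)).2 (by norm_num)
  rw [div_le_iff₀ (by positivity)]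
  nlinarith [Real.log_two_lt_d9]

/-- `2Λ(3)/√3 ≤ 1.2686`. [folklore] -/
theorem two_vonMangoldt_div_sqrt_three_le : 2 * (Λ 3 : ℝ) / Real.sqrt ((3 : ℕ) : ℝ) ≤ 12686 / 10000 := by
  rw [ArithmeticFunction.vonMangoldt_apply_prime Nat.prime_three]
  push_cast
  have hs : (17320508 : ℝ) / 10000000 ≤ Real.sqrt 3 := (Real.le_sqrt (by norm_num) (by norm_num)).2 (by norm_num)
  rw [div_le_iff₀ (by positivity)]
  nlinarith [Real.log_three_lt_d9]

/-- `2Λ(4)/√4 = log 2 ≤ 0.6932`. [folklore] -/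
theorem two_vonMangoldt_div_sqrt_four_le : 2 * (Λ 4 : ℝ) / Real.sqrt ((4 : ℕ) : ℝ) ≤ 6932 / 10000 := by
  rw [show (4 : ℕ) = 2 ^ 2 by norm_num, ArithmeticFunction.vonMangoldt_apply_pow (by norm_num),
    ArithmeticFunction.vonMangoldt_apply_prime Nat.prime_two]
  push_cast
  rw [show (4 : ℝ) = 2 ^ 2 by norm_num, Real.sqrt_sq (by norm_num)]
  linarith [Real.log_two_lt_d9]

/-- `2Λ(5)/√5 ≤ 1.4396`. [folklore] -/
theorem two_vonMangoldt_div_sqrt_five_le : 2 * (Λ 5 : ℝ) / Real.sqrt ((5 : ℕ) : ℝ) ≤ 14396 / 10000 := by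
  have hp : Nat.Prime 5 := by norm_num
  rw [ArithmeticFunction.vonMangoldt_apply_prime hp]
  push_cast
  have hs : (22360679 : ℝ) / 10000000 ≤ Real.sqrt 5 := (Real.le_sqrt (by norm_num) (by norm_num)).2 (by norm_num)
  rw [div_le_iff₀ (by positivity)]
  nlinarith [log_five_le]

/-- `2Λ(6)/√6 = 0`. [folklore] -/
theorem two_vonMangoldt_div_sqrt_six : 2 * (Λ 6 : ℝ) / Real.sqrt ((6 : ℕ) : ℝ) = 0 := by
  rw [ArithmeticFunction.vonMangoldt_eq_zero_iff.2 not_isPrimePow_six]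
  simp

/-- `2Λ(7)/√7 ≤ 1.4710`. [folklore] -/
theorem two_vonMangoldt_div_sqrt_seven_le : 2 * (Λ 7 : ℝ) / Real.sqrt ((7 : ℕ) : ℝ) ≤ 14710 / 10000 := by
  have hp : Nat.Prime 7 := by norm_num
  rw [ArithmeticFunction.vonMangoldt_apply_prime hp]
  push_cast
  have hs : (26457513 : ℝ) / 10000000 ≤ Real.sqrt 7 := (Real.le_sqrt (by norm_num) (by norm_num)).2 (by norm_num)
  rw [div_le_iff₀ (by positivity)]
  nlinarith [log_seven_le]

/-- `2Λ(8)/√8 = log 2/√2 ≤ 0.4902`. [folklore] -/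
theorem two_vonMangoldt_div_sqrt_eight_le : 2 * (Λ 8 : ℝ) / Real.sqrt ((8 : ℕ) : ℝ) ≤ 4902 / 10000 := by
  rw [show (8 : ℕ) = 2 ^ 3 by norm_num, ArithmeticFunction.vonMangoldt_apply_pow (by norm_num),
    ArithmeticFunction.vonMangoldt_apply_prime Nat.prime_two]
  push_cast
  have hs : (28284271 : ℝ) / 10000000 ≤ Real.sqrt 8 :=
    (Real.le_sqrt (by norm_num) (by norm_num)).2 (by norm_num)
  rw [div_le_iff₀ (by positivity)]
  nlinarith [Real.log_two_lt_d9]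

/-- `2Λ(9)/√9 = 2 log 3 / 3 ≤ 0.7325`. [folklore] -/
theorem two_vonMangoldt_div_sqrt_nine_le : 2 * (Λ 9 : ℝ) / Real.sqrt ((9 : ℕ) : ℝ) ≤ 7325 / 10000 := by
  rw [show (9 : ℕ) = 3 ^ 2 by norm_num, ArithmeticFunction.vonMangoldt_apply_pow (by norm_num),
    ArithmeticFunction.vonMangoldt_apply_prime Nat.prime_three]
  push_cast
  rw [show (9 : ℝ) = 3 ^ 2 by norm_num, Real.sqrt_sq (by norm_num)]
  linarith [Real.log_three_lt_d9]

end ripple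

end Summit.Ventures.WeilGRH

end
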